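import Summits.AtomisticToContinuum.Crystallization.Theorems.FrustratedLawDichotomyStrainedPatchRecutLSA

/-!
# LEAST SQUARES ON THE CHART SIDE: (R1) moved to the ∃ side (ROOMᴸ), the `Q`-threaded seams, and the ♭ record `coreOff_record_g55b`
# (27623 strained-patch piece, T-side [CORE-FAR]; decomp-a2c lens-5 «RecutPairs», generation 54 → 55)

**FILE SPLIT (gate 400-line cap, hand-2 g27 landing edit; statements and proofs byte-identical):** this file = PART B of lens-5 g54's `…RecutLS` fb7a54c51c84db0a (from `levelNear_kN1_of_recutOf` on); PART A is `…RecutLSA` (imported; same namespace, so every fully-qualified name is unchanged).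

(Imports `…RecutLevelGap` and the tree's `…WindowTaylorTail` (for `taylorTwoBentW_holds`).)

THE OBSERVATION.  In the record `coreOff_record_g54W_T2` the only binder quantifying over ALL charts of the family with a claim about the least-squares matrix
is (RFᴿ) — through its core (R1) `‖A_LS‖ ≤ κL₀·t` — and the level-0 seam `edgeFar_of_familyRecutCap` feeds (F1ᴿ-cap) ONE chart only: (F2)'s chart of the
rotated cluster at `t = T₀(z₀)`.  A small bound on `A_LS` is FALSE as a ∀-chart claim (a pure homogeneous-strain offset chart is a valid `ChartBy` chart and has
`‖A_LS‖/t = 1/6.3`; mixtures with box modes reach `0.29`; census KAPPAL28: sup `0.3915 < κL₀ = 2/5`, margin 2 %), but it is CHEAP on (F2)'s own chart (census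
LSW28: realised `‖A_LS‖/t ≤ 0.139` on admissible rays).  So (R1) belongs on the ∃ side.

THE MOVE.  Least squares is formulated on the CHART side (§1): `LSAt A …` = the normal equations of the `A`-corrected deviation `dev₀ − A·x₀` against the recut
design `(1+A)x₀` on the uncapped annulus; `LSNear κ … t := ∃ A, ‖A‖ ≤ κ·max t 0 ∧ LSAt A …`.  ★ `projectedFree_of_recutOf`: for a centre-keeping recut
`RecutOf A` the chart-side normal equations ARE `projectedFree` of the recut (the recut relabels every uncapped site by `(1+A)`, `recutOf_label`; `dev₁ = dev₀ − A x₀`;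
the residual clause with `u := dev₀`, `L := A(1+A)⁻¹`).  A cluster–chart predicate `Q` is threaded through exactly THREE binders (§2): `AffineRecutQ Q` (RF only for
`Q`-charts), `FamilyEnvelopeRecutCapQ Q`, `FamilyRoomQ Q` (ROOM's chart satisfies `Q`); the level-2 `Paired*` binders, (DOMᴿ) and (F3ᴿ) are UNCHANGED in shape.
The seams re-prove verbatim (`familyEnvelopeRecutCapQ_of_pieces`, `edgeFar_of_familyRecutCapQ`, `coreOff_of_familyRecutCapQ_of_band_of_soft`).

THE THEOREMS (§3).  ★★★ `affineRecutQ_of_good`: for `0 ≤ κ ≤ κ♭₀ := 3/20`, (R7ᴸ)_κ `RecutGoodWith 𝓘₀ᴿʷˢ κ` (the good window of the recut centre) ⟹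
`AffineRecutQ (LSNear κ) 𝓘₀ᴿʷˢ 𝓘₁ʷ 𝓑₀ τ₀ τ₁ κN₁ κ T₀` with the ORIGINAL level constant `κN₁ = 1/3` (`levelNear_kN1_of_recutOf`: at `‖A‖ ≤ κt ≤ 1/400` the transport
gives `(2 + 2·0.07)·κ/(1 − 2κt) ≤ 0.3226 ≤ 1/3`; chart-side columns `ShellGap (1/20)`, `nn ≤ 7/5` of `𝓘₀ᴿʷᴳ`) — so the tree's `Phi1` tables stay; and ★★★
`recutGoodWith_of_le`: (R7ᴸ)_κ ITSELF is a theorem for `κ ≤ 3/20` (image level `(1/16 + (2 + 1/16)α)/(1−α) ≤ 0.0678 ≤ 7/100` at `α ≤ 1/400`), hence ★★★★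
`recutLSG_holds : RecutLSG` — the recut/refit binder (RF) of the g53/g54 records is DISCHARGED COMPLETELY at the small radius.

THE ♭ RECORD (§4, pins `kLb = 3/20`).  ★★★★ `coreOff_record_g55b (BASᴳ) (MEMᴳ μ) (LINᴳ Ψ) (DOMᴳ (Ψ+ϱ₀+μ)) (ROOMᴸ) (F3ᴳ) [BRIDGE] [SOFT-FAR] : [CORE-FAR]`:
(RFᴿ) is GONE (the theorem `recutLSG_holds`); (T2) is the tree theorem `taylorTwoBentW_holds`; every TABLE / ANALYTIC binder is the `g54W` binder RESTRICTED to the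
smaller family `𝓘₀ᴿʷˢ` and the smaller recut ball `κ♭₀ = 3/20 < κL₀ = 2/5` (`basinRBentG_of_W`, …, `familyCertRBentG_of_W`: each is IMPLIED by its `g54W`
counterpart); the one STRENGTHENED binder is (ROOMᴸ) `FamilyRoomLSG` = (F2ᴿ-bentW0) on `𝓘₀ᴿʷˢ` + «the room chart is `κ♭₀·T₀`-LS-near» (∃-side; census LSW28
`0.139 ≤ 0.15`, KAPPA-ADM owed).  Budget effect (census H0COL28/BUDGET54 bookkeeping): the worst-case recut allowance `‖dS/dA‖_F·κL·T₀` scales by `κ♭₀/κL₀ = 3/8`.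
No sorry, no new axioms, no cite tokens, no instances / notation.  `--supports stmt-AtomisticToContinuum-27623`.
-/

noncomputable section

namespace Summit.AtomisticToContinuum.Crystallization.Theorems.FrustratedLawDichotomyStrainedPatchRecutLS

open scoped BigOperators Classical
open Summit.AtomisticToContinuum.Crystallization.Theorems.FrustratedLawDichotomyPeriodicBlockFlags (goodAtScale_mono)
open Summit.AtomisticToContinuum.Crystallization.Theorems.FrustratedLawDichotomyRangeCut (Sep)
open Summit.AtomisticToContinuum.Crystallization.Theorems.FrustratedLawDichotomyMotifLemmas
open Summit.AtomisticToContinuum.Crystallization.Theorems.FrustratedLawDichotomyAveragingCut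
open Summit.AtomisticToContinuum.Crystallization.Theorems.FrustratedLawDichotomyAveragingRuleCap
open Summit.AtomisticToContinuum.Crystallization.Theorems.FrustratedLawDichotomyAveragingRuleTightFree
open Summit.AtomisticToContinuum.Crystallization.Theorems.FrustratedLawDichotomyExemptDoor (SitePred)
open Summit.AtomisticToContinuum.Crystallization.Theorems.FrustratedLawDichotomyExemptAbsorption
open Summit.AtomisticToContinuum.Crystallization.Theorems.FrustratedLawDichotomyExemptAbsorptionRecord
open Summit.AtomisticToContinuum.Crystallization.Theorems.FrustratedLawDichotomyCollarCensus
open Summit.AtomisticToContinuum.Crystallization.Theorems.FrustratedLawDichotomyCollarCensusKappa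
open Summit.AtomisticToContinuum.Crystallization.Theorems.FrustratedLawDichotomyStrainedPatchHomSplit
open Summit.AtomisticToContinuum.Crystallization.Theorems.FrustratedLawDichotomyStrainedPatchCleanCollar
open Summit.AtomisticToContinuum.Crystallization.Theorems.FrustratedLawDichotomyStrainedPatchHomTube
open Summit.AtomisticToContinuum.Crystallization.Theorems.FrustratedLawDichotomyStrainedPatchHomIsometry
open Summit.AtomisticToContinuum.Crystallization.Theorems.FrustratedLawDichotomyStrainedPatchHomTubeIso
open Summit.AtomisticToContinuum.Crystallization.Theorems.FrustratedLawDichotomyStrainedPatchPhaseCut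
open Summit.AtomisticToContinuum.Crystallization.Theorems.FrustratedLawDichotomyStrainedPatchCoreTube
open Summit.AtomisticToContinuum.Crystallization.Theorems.FrustratedLawDichotomyStrainedPatchCoreTubeRecord
open Summit.AtomisticToContinuum.Crystallization.Theorems.FrustratedLawDichotomyStrainedPatchCoreTubeMilli
open Summit.AtomisticToContinuum.Crystallization.Theorems.FrustratedLawDichotomyStrainedPatchStrainBands
open Summit.AtomisticToContinuum.Crystallization.Theorems.FrustratedLawDichotomyStrainedPatchChartFamilies
open Summit.AtomisticToContinuum.Crystallization.Theorems.FrustratedLawDichotomyStrainedPatchChartFamiliesBent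
open Summit.AtomisticToContinuum.Crystallization.Theorems.FrustratedLawDichotomyStrainedPatchChartFamiliesPinned
open Summit.AtomisticToContinuum.Crystallization.Theorems.FrustratedLawDichotomyStrainedPatchEnvelopeLaw
open Summit.AtomisticToContinuum.Crystallization.Theorems.FrustratedLawDichotomyStrainedPatchEnvelopeTaylor
open Literature.Barriers.AtomisticToContinuum.FlatleyTheil2015 (fccVec)
open Summit.AtomisticToContinuum.Crystallization.Theorems.FrustratedLawDichotomyStrainedPatchRecutPairs
open Summit.AtomisticToContinuum.Crystallization.Theorems.FrustratedLawDichotomyStrainedPatchRecutKinematics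
open Literature.Barriers.AtomisticToContinuum.FlatleyTheil2015 (fccPoint)
open Summit.AtomisticToContinuum.Crystallization.Theorems.FrustratedLawDichotomyStrainedPatchHomRelief (latPt_fccVec_eq)
open Summit.AtomisticToContinuum.Crystallization.Theorems.FrustratedLawDichotomyStrainedPatchHomLatticeBox (norm_apply_ge_of_near_one latPt_zero
  mem_box_of_norm_fccPoint_lt)
open Summit.AtomisticToContinuum.Crystallization.Theorems.FrustratedLawDichotomyStrainedPatchHomLatticeBoxHcp (latPt_eq_apply_one shifted_eq_apply)
open Summit.AtomisticToContinuum.Crystallization.Theorems.FrustratedLawDichotomyStrainedPatchHomLatticeBoxWindow (mem_box_of_norm_hexPt_lt'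
  mem_box_of_norm_hexPt_add_shift_lt')
open Summit.AtomisticToContinuum.Crystallization.Theorems.FrustratedLawDichotomyStrainedPatchWindowFamilies
open Summit.AtomisticToContinuum.Crystallization.Theorems.FrustratedLawDichotomyStrainedPatchRecutBuild
open Summit.AtomisticToContinuum.Crystallization.Theorems.FrustratedLawDichotomyStrainedPatchRecutRecord
open Summit.AtomisticToContinuum.Crystallization.Theorems.FrustratedLawDichotomyStrainedPatchRecutChart
open Literature.Geometry.DiscreteGeometry (nearestDist nearestDist_le_dist le_nearestDist exists_nearestDist_eq_dist nearestDist_nonneg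
  fccKissingPattern hcpKissingPattern card_fccKissingPattern card_hcpKissingPattern norm_eq_one_of_mem_fccKissingPattern norm_eq_one_of_mem_hcpKissingPattern)
open Summit.AtomisticToContinuum.Crystallization.Theorems.FrustratedLawDichotomyStrainedPatchRecutLevel
open Summit.AtomisticToContinuum.Crystallization.Theorems.FrustratedLawDichotomyStrainedPatchRecutLevelGap
open Summit.AtomisticToContinuum.Crystallization.Theorems.FrustratedLawDichotomyStrainedPatchWindowTaylorTail (taylorTwoBentW_holds)

/-- ★★ **(R6)♭ THE RECUT AT RADIUS `κ ≤ 3/20` IS `κN₁ = 1/3`-LEVEL-NEAR** — for a centre-keeping recut `RecutOf A` with `‖A‖ ≤ κ·max t 0`, `0 ≤ κ ≤ 3/20`,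
`0 ≤ t ≤ 1/60` (so `α = κt ≤ 1/400`), both injective, and the CHART-SIDE columns `ShellGap (1/50) z₀ c₀` (recut side `1/100 = 4·(1/400)` by `shellGap_recut`),
`nn ≤ 7/5`, `GoodAtScale (1/16) (3/2) z₀ c₀`: `LevelNear κN₁ t z₀ c₀ z₁ c₁` (`|η₁ − η₀| ≤ (2 + 2·max η)·α/(1 − 2α)` with `max η ≤ 7/100`:
`2.14·(3/20)/(1 − 1/200) = 0.3226 ≤ 1/3`).  The ORIGINAL level constant of the g53 record survives at the small recut radius: the tree's `Phi1` tables are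
reusable. [folklore] -/
theorem levelNear_kN1_of_recutOf {A : E3 →L[ℝ] E3} {M₀ : ℕ} {z₀ : Fin M₀ → E3} {c₀ : Fin M₀} {M₁ : ℕ} {z₁ : Fin M₁ → E3} {c₁ : Fin M₁} {M : ℕ}
    {e₀ : Fin M → Fin M₀} {e₁ : Fin M → Fin M₁} (h : RecutOf A z₀ c₀ z₁ c₁ e₀ e₁) {t κ : ℝ} (hA : ‖A‖ ≤ κ * max t 0) (hκ0 : 0 ≤ κ) (hκ : κ ≤ 3 / 20)
    (ht : 0 ≤ t) (ht60 : t ≤ 1 / 60) (hinj₀ : Function.Injective z₀) (hinj₁ : Function.Injective z₁) (HG₀ : ShellGap (1 / 50) z₀ c₀)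
    (hnn : nearestDist z₀ c₀ ≤ 7 / 5) (h16 : GoodAtScale (1 / 16) (3 / 2) z₀ c₀) : LevelNear kN1 t z₀ c₀ z₁ c₁ := by
  have hmax : max t 0 = t := max_eq_left ht
  have hA' : ‖A‖ ≤ κ * t := by rw [hmax] at hA; exact hA
  have hα0 : 0 ≤ κ * t := mul_nonneg hκ0 ht
  have hαt : κ * t ≤ 3 / 20 * t := mul_le_mul_of_nonneg_right hκ ht
  have hα400 : κ * t ≤ 1 / 400 := by linarith
  have hα150 : κ * t ≤ 1 / 150 := by linarith
  have hα25 : κ * t ≤ 1 / 25 := by linarith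
  have hnn0 := nearestDist_nonneg z₀ c₀
  obtain ⟨H1, H2⟩ := recutOf_local h (hA'.trans hα150)
  have hex := exists_ne_of_goodAtScale h16
  have HG₁ : ShellGap (1 / 100) z₁ c₁ :=
    shellGap_recut hinj₀ hinj₁ A hA' (by linarith) H1 H2 hex (by linarith) (by norm_num) (by norm_num) (by linarith) HG₀
  have h8 : GoodAtScale (1 / 8) (3 / 2) z₀ c₀ := goodAtScale_mono (by norm_num) h16
  have hdn : (κ * t) * nearestDist z₀ c₀ ≤ 1 / 400 * (7 / 5) := mul_le_mul hα400 hnn hnn0 (by norm_num)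
  have hd' : (1 + κ * t) * nearestDist z₀ c₀ ≤ 3 / 2 * (1 - κ * t) := by nlinarith
  have hD : (1 + κ * t) * nearestDist z₀ c₀ ≤ 3 / 2 := by nlinarith
  have habs := abs_fitLevel_recut_le hinj₀ hinj₁ A hA' hα25 (g := 1 / 100) (by linarith) (by norm_num) (by norm_num) H1 H2 (HG₀.mono (by norm_num))
    HG₁ hd' h8
  have hf₀ : fitLevel z₀ c₀ ≤ 1 / 16 := fitLevel_le_of_goodAtScale h16
  have hf₁ : fitLevel z₁ c₁ ≤ 7 / 100 := by
    have h1 := fitLevel_le_of_goodAtScale (goodAtScale_recut hinj₀ hinj₁ A hA' (by linarith) (g := 1 / 100) (by linarith) (by norm_num) (by norm_num)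
      H1 H2 (HG₀.mono (by norm_num)) (by linarith) (by norm_num : (1 / 16 : ℝ) ≤ 1) hD h16)
    refine h1.trans ?_
    rw [div_le_iff₀ (by linarith)]
    linarith
  have hM : max (fitLevel z₀ c₀) (fitLevel z₁ c₁) ≤ 7 / 100 := max_le (by linarith) hf₁
  show |fitLevel z₁ c₁ - fitLevel z₀ c₀| ≤ kN1 * max t 0
  rw [hmax, kN1]
  refine habs.trans ?_
  rw [div_le_iff₀ (by linarith)]
  have h1 : (2 + 2 * max (fitLevel z₀ c₀) (fitLevel z₁ c₁)) * (κ * t) ≤ (2 + 2 * (7 / 100)) * (κ * t) :=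
    mul_le_mul_of_nonneg_right (by linarith) hα0
  have h3 : t * (κ * t) ≤ t * (1 / 400) := mul_le_mul_of_nonneg_left hα400 ht
  nlinarith

/-- **(R7ᴸ)_𝓘₀,κ `RecutGoodWith 𝓘₀ κ`** [THE GOOD WINDOW of the recut centre · NUMERICAL / INSTRUMENTABLE (census GOOD27: `η(z₁) ≤ 0.06439 < 7/100` on admissible
rays)] — for every admissible clean mono-phase cluster charted by `z₀ ∈ 𝓘₀` (coarse `1/4`, fine `0 ≤ t ≤ T₀(z₀)`), every chart-side least-squares matrix `A`
(`‖A‖ ≤ κ·max t 0`, `LSAt A …`) and every INJECTIVE centre-keeping recut of the chart by `A`: the recut centre is `η₃₀ = 7/100`-good at cap `3/2`. -/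
def RecutGoodWith (𝓘₀ : (M₀ : ℕ) → (Fin M₀ → E3) → Fin M₀ → Prop) (κ : ℝ) : Prop :=
  ∀ (M : ℕ) (z : Fin M → E3) (c : Fin M) (M₀ : ℕ) (z₀ : Fin M₀ → E3) (c₀ : Fin M₀) (e₀ : Fin M → Fin M₀) (t : ℝ),
    Admissible M z c → CleanBall (63 / 10) z c → MonoPhaseBall (63 / 10) z c → 0 ≤ t → t ≤ T0 M₀ z₀ c₀ → ChartBy 𝓘₀ tau0 t z c z₀ c₀ e₀ →
      ∀ A : E3 →L[ℝ] E3, ‖A‖ ≤ κ * max t 0 → LSAt A M z c M₀ z₀ c₀ e₀ →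
        ∀ (M₁ : ℕ) (z₁ : Fin M₁ → E3) (c₁ : Fin M₁) (e₁ : Fin M → Fin M₁), RecutOf A z₀ c₀ z₁ c₁ e₀ e₁ → z₁ c₁ = z₀ c₀ → Function.Injective z₁ →
          GoodAtScale eta30 (3 / 2) z₁ c₁

/-- (R7ᴸ) is ANTITONE in the chart family. [formal bookkeeping] -/
theorem RecutGoodWith.anti {𝓘 𝓘' : (M₀ : ℕ) → (Fin M₀ → E3) → Fin M₀ → Prop} (hle : FamilyLE 𝓘 𝓘') {κ : ℝ} (h : RecutGoodWith 𝓘' κ) :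
    RecutGoodWith 𝓘 κ :=
  fun M z c M₀ z₀ c₀ e₀ t hadm hclean hmono ht ht' hch => h M z c M₀ z₀ c₀ e₀ t hadm hclean hmono ht ht' (hch.mono_family hle)

/-- (R7ᴸ) follows from the least-squares CORE's good clause whenever the core's matrix is the chart-side LS matrix — recorded only as the trivial direction
«(LS-CORE) with `κ`-small matrix ⟹ nothing new»; the core quantifies `∃ A`, (R7ᴸ) quantifies `∀ A` with `LSAt A`, so neither implies the other formally.
What IS formal: (R7ᴸ) is antitone in `κ`. [formal bookkeeping] -/
theorem RecutGoodWith.anti_radius {𝓘 : (M₀ : ℕ) → (Fin M₀ → E3) → Fin M₀ → Prop} {κ κ' : ℝ} (hle : κ ≤ κ') (h : RecutGoodWith 𝓘 κ') :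
    RecutGoodWith 𝓘 κ :=
  fun M z c M₀ z₀ c₀ e₀ t hadm hclean hmono ht ht' hch A hA hLS =>
    h M z c M₀ z₀ c₀ e₀ t hadm hclean hmono ht ht' hch A (hA.trans (mul_le_mul_of_nonneg_right hle (le_max_right _ _))) hLS

/-- ★★★ **(R7ᴸ) IS A THEOREM AT RADIUS `κ ≤ 3/20`** — on `𝓘₀ᴿʷˢ` (centre `1/16`-good, `ShellGap (1/50)`, `nn ≤ 7/5`, injective) every injective centre-keeping recut
by `A` with `‖A‖ ≤ κ·max t 0 ≤ 1/400` has a `7/100`-good centre: `goodAtScale_recut` gives the image level `(1/16 + (2 + 1/16)α)/(1 − α) ≤ 0.0678 ≤ η₃₀ = 7/100`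
(`α ≤ 1/400`).  The (R7) good window of rows 1006 (iii) / 1010 (v) CLOSES at the small radius — the «admissible-κ split» (g6) typed as a theorem: kinematics never
needed `κL₀ = 2/5` on the ∃ side. [folklore] -/
theorem recutGoodWith_of_le {κ : ℝ} (hκ0 : 0 ≤ κ) (hκ : κ ≤ 3 / 20) : RecutGoodWith ChartFamilyRWS κ := by
  intro M z c M₀ z₀ c₀ e₀ t hadm hclean hmono ht ht' hch A hA _ M₁ z₁ c₁ e₁ hRO _ hinj₁
  have hI : ChartFamilyRWS M₀ z₀ c₀ := hch.1
  have hinj₀ : Function.Injective z₀ := hI.1.1.1.1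
  have h16 : GoodAtScale (1 / 16) (3 / 2) z₀ c₀ := hI.1.1.2.2
  have ht60 : t ≤ 1 / 60 := ht'.trans (T0_le_of_goodAtScale h16)
  have hmax : max t 0 = t := max_eq_left ht
  have hA' : ‖A‖ ≤ κ * t := by rw [hmax] at hA; exact hA
  have hα0 : 0 ≤ κ * t := mul_nonneg hκ0 ht
  have hαt : κ * t ≤ 3 / 20 * t := mul_le_mul_of_nonneg_right hκ ht
  have hα400 : κ * t ≤ 1 / 400 := by linarith
  have hnn : nearestDist z₀ c₀ ≤ 7 / 5 := hI.2.2
  have hnn0 := nearestDist_nonneg z₀ c₀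
  obtain ⟨H1, H2⟩ := recutOf_local hRO (hA'.trans (by linarith))
  have hD : (1 + κ * t) * nearestDist z₀ c₀ ≤ 3 / 2 := by nlinarith
  have hg := goodAtScale_recut hinj₀ hinj₁ A hA' (by linarith) (g := 1 / 100) (by linarith) (by norm_num) (by norm_num) H1 H2 (hI.2.1.mono (by norm_num))
    (by linarith) (by norm_num : (1 / 16 : ℝ) ≤ 1) hD h16
  refine goodAtScale_mono ?_ hg
  rw [eta30, div_le_iff₀ (by linarith)]
  linarith

/-- ★★★ **(RFᴿ)_LSNear FROM THE GOOD WINDOW ALONE** — for `0 ≤ κ ≤ 3/20`: (R7ᴸ)_κ on `𝓘₀ᴿʷˢ` ⟹ `AffineRecutQ (LSNear κ) 𝓘₀ᴿʷˢ 𝓘₁ʷ 𝓑₀ τ₀ τ₁ κN₁ κ T₀`.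
Existence, `RecutNear` at radius `κ`, injectivity, separation, bentness, membership and the coarse chart: `exists_chart_recut_at`; the LEVEL clause at `κN₁ = 1/3`:
`levelNear_kN1_of_recutOf` on the two geometric columns of `𝓘₀ᴿʷˢ` (`ShellGap (1/50)`, `nn ≤ 7/5`); `projectedFree`: `projectedFree_of_recutOf` from the chart-side normal equations `LSAt A`
that `LSNear κ` supplies.  (R1) is no longer a hypothesis of anything: it sits inside the ∃-side predicate `LSNear`. [folklore] -/
theorem affineRecutQ_of_good {κ : ℝ} (hκ0 : 0 ≤ κ) (hκ : κ ≤ 3 / 20) (h : RecutGoodWith ChartFamilyRWS κ) :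
    AffineRecutQ (LSNear κ) ChartFamilyRWS CompFamilyW bends0 tau0 tau1 kN1 κ T0 := by
  intro M z c M₀ z₀ c₀ e₀ t hadm hclean hmono ht ht' hch hQ
  obtain ⟨A, hA, hLS⟩ := hQ
  have hI : ChartFamilyRWS M₀ z₀ c₀ := hch.1
  have hch' : ChartBy ChartFamilyRW tau0 t z c z₀ c₀ e₀ := hch.mono_family chartFamilyRWS_le
  have hκL : κ ≤ kL0 := hκ.trans (by rw [kL0]; norm_num)
  obtain ⟨M₁, z₁, c₁, e₁, hRO, hy, hRN, hinj₁, -, -, hchart⟩ := exists_chart_recut_at hch' ht ht' A hA hκL (z₀ c₀)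
  have hinj₀ : Function.Injective z₀ := hI.1.1.1.1
  have h16 : GoodAtScale (1 / 16) (3 / 2) z₀ c₀ := hI.1.1.2.2
  have ht60 : t ≤ 1 / 60 := ht'.trans (T0_le_of_goodAtScale h16)
  have hmax : κ * max t 0 ≤ 1 / 400 := by
    rw [max_eq_left ht]
    exact (mul_le_mul hκ ht60 ht (by norm_num)).trans (by norm_num)
  have hA150 : ‖A‖ ≤ 1 / 150 := hA.trans (hmax.trans (by norm_num))
  have hgood : GoodAtScale eta30 (3 / 2) z₁ c₁ := h M z c M₀ z₀ c₀ e₀ t hadm hclean hmono ht ht' hch A hA hLS M₁ z₁ c₁ e₁ hRO hy hinj₁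
  have hpf : projectedFree M z c M₁ z₁ c₁ e₁ t :=
    projectedFree_of_recutOf hRO hA150 (fun a ha => ((chartBy_uncapped hch ha).1).trans (by rw [tau0]; norm_num))
      (fun a ha => (chartBy_uncapped hch ha).2) hLS
  exact ⟨M₁, z₁, c₁, e₁, levelNear_kN1_of_recutOf hRO hA hκ0 hκ ht ht60 hinj₀ hinj₁ hI.2.1 hI.2.2 h16, hRN, hchart hgood, hpf⟩

/-! ## §4. Pins `κ♭₀ = 3/20` and the ♭ record over LS-near charts -/

/-- `κ♭₀ = 3/20` — the LS-nearness radius of the ROOM chart (census LSW28: realised `‖A_LS‖/t ≤ 0.139` on admissible rays, margin 8 %; `< κL₀ = 2/5`). -/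
def kLb : ℝ := 3 / 20

/-- `κ♭₀ ≤ κL₀`. [formal bookkeeping] -/
theorem kLb_le_kL0 : kLb ≤ kL0 := by rw [kLb, kL0]; norm_num

/-- **(BASᴿ-bentG) `BasinRBentG`** := `PairedBasin projectedFree 𝓘₀ᴿʷˢ 𝓘₁ʷ 𝓑₀ τ₀ τ₁ κ♭₀ T₀ δ₀` [ANALYTIC · UNDECIDED · INSTRUMENTABLE]. -/
def BasinRBentG : Prop := PairedBasin projectedFree ChartFamilyRWS CompFamilyW bends0 tau0 tau1 kLb T0 delta0

/-- **(MEMᴿ-bentG μ) `MembershipRBentG μ`** := `PairedMembership 𝓘₀ᴿʷˢ 𝓘₁ʷ 𝓑₀ τ₀ τ₁ κ♭₀ T₀ δ₀ μ` [TABLE]. -/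
def MembershipRBentG (μ : (M₁ : ℕ) → (Fin M₁ → E3) → Fin M₁ → ℝ) : Prop := PairedMembership ChartFamilyRWS CompFamilyW bends0 tau0 tau1 kLb T0 delta0 μ

/-- **(LINᴿ-bentG Ψ) `SlavedRBentG Ψ`** := `PairedSlaved projectedFree 𝓘₀ᴿʷˢ 𝓘₁ʷ 𝓑₀ τ₀ τ₁ κ♭₀ T₀ δ₀ 𝔊₀ 𝔴₀ Ψ` [MECHANICS · UNDECIDED · INSTRUMENTABLE]. -/
def SlavedRBentG (Ψ : (M₁ : ℕ) → (Fin M₁ → E3) → Fin M₁ → ℝ → ℝ) : Prop :=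
  PairedSlaved projectedFree ChartFamilyRWS CompFamilyW bends0 tau0 tau1 kLb T0 delta0 G0 w0 Ψ

/-- **(ENVᴿ-bentG Ψ) `EnvelopeRBentG Ψ`** := `PairedEnvelopeOn projectedFree 𝓘₀ᴿʷˢ 𝓘₁ʷ 𝓑₀ τ₀ τ₁ κ♭₀ T₀ Ψ` [ANALYTIC; a theorem from the three above + (T2)]. -/
def EnvelopeRBentG (Ψ : (M₁ : ℕ) → (Fin M₁ → E3) → Fin M₁ → ℝ → ℝ) : Prop :=
  PairedEnvelopeOn projectedFree ChartFamilyRWS CompFamilyW bends0 tau0 tau1 kLb T0 Ψ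

/-- **(R7ᴸ) `RecutGoodG`** := `RecutGoodWith 𝓘₀ᴿʷˢ κ♭₀` — a THEOREM (`recutGoodG_holds`, §3); kept as a name for bookkeeping. -/
def RecutGoodG : Prop := RecutGoodWith ChartFamilyRWS kLb

/-- **(RFᴿ)ᴸ `RecutLSG`** := `AffineRecutQ (LSNear κ♭₀) 𝓘₀ᴿʷˢ 𝓘₁ʷ 𝓑₀ τ₀ τ₁ κN₁ κ♭₀ T₀` — a THEOREM from (R7ᴸ) (`recutLSG_of_good`). -/
def RecutLSG : Prop := AffineRecutQ (LSNear kLb) ChartFamilyRWS CompFamilyW bends0 tau0 tau1 kN1 kLb T0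

/-- **(DOMᴿ-bentG Ψ) `DominationRBentG Ψ`** := `RecutDomination 𝓘₀ᴿʷˢ 𝓘₁ʷ 𝓑₀ κN₁ κ♭₀ T₀ Ψ Φ₁` [TABLE over recut pairs at radius `κ♭₀`, level `κN₁`; the tree's `Phi1`]. -/
def DominationRBentG (Ψ : (M₁ : ℕ) → (Fin M₁ → E3) → Fin M₁ → ℝ → ℝ) : Prop := RecutDomination ChartFamilyRWS CompFamilyW bends0 kN1 kLb T0 Ψ Phi1

/-- **(F1ᴿ-cap)ᴸ `FamilyEnvelopeCapRBentG`** := `FamilyEnvelopeRecutCapQ (LSNear κ♭₀) 𝓘₀ᴿʷˢ 𝓘₁ʷ 𝓑₀ τ₀ κN₁ κ♭₀ Φ₁ T₀` [ANALYTIC; level-1 node]. -/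
def FamilyEnvelopeCapRBentG : Prop := FamilyEnvelopeRecutCapQ (LSNear kLb) ChartFamilyRWS CompFamilyW bends0 tau0 kN1 kLb Phi1 T0

/-- **(F2ᴿ)ᴸ = (ROOMᴸ) `FamilyRoomLSG`** := `FamilyRoomQ (LSNear κ♭₀) 𝓘₀ᴿʷˢ (24/5) (1/100) η_E τ₀ T₀` [GEOMETRIC + ∃-side NUMERICAL · INSTRUMENTABLE (census
LSW28, SHELLGAP27)] — the room law on the designate family `𝓘₀ᴿʷˢ` whose chart is, in addition, `κ♭₀·T₀`-LS-near.  THE strengthened binder of the ♭ record. -/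
def FamilyRoomLSG : Prop := FamilyRoomQ (LSNear kLb) ChartFamilyRWS (24 / 5) (1 / 100) etaE tau0 T0

/-- **(F3ᴿ-bentG) `FamilyCertRBentG`** := `FamilyCertRecut 𝓘₀ᴿʷˢ 𝓘₁ʷ 𝓑₀ κN₁ κ♭₀ 0 Φ₁ T₀` [TABLE CERTIFICATE over recut pairs at radius `κ♭₀`]. -/
def FamilyCertRBentG : Prop := FamilyCertRecut ChartFamilyRWS CompFamilyW bends0 kN1 kLb 0 Phi1 T0

/-- (BASᴿ-bentW) ⟹ (BASᴿ-bentG). [formal bookkeeping] -/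
theorem basinRBentG_of_W (h : BasinRBentW) : BasinRBentG := pairedBasin_anti chartFamilyRWS_le kLb_le_kL0 h

/-- (MEMᴿ-bentW μ) ⟹ (MEMᴿ-bentG μ). [formal bookkeeping] -/
theorem membershipRBentG_of_W {μ : (M₁ : ℕ) → (Fin M₁ → E3) → Fin M₁ → ℝ} (h : MembershipRBentW μ) : MembershipRBentG μ :=
  pairedMembership_anti chartFamilyRWS_le kLb_le_kL0 h

/-- (LINᴿ-bentW Ψ) ⟹ (LINᴿ-bentG Ψ). [formal bookkeeping] -/
theorem slavedRBentG_of_W {Ψ : (M₁ : ℕ) → (Fin M₁ → E3) → Fin M₁ → ℝ → ℝ} (h : SlavedRBentW Ψ) : SlavedRBentG Ψ :=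
  pairedSlaved_anti chartFamilyRWS_le kLb_le_kL0 h

/-- (DOMᴿ-bentW Ψ) (the g53/g54 domination at level `κN₁`, radius `κL₀`) ⟹ (DOMᴿ-bentG Ψ). [formal bookkeeping] -/
theorem dominationRBentG_of_W {Ψ : (M₁ : ℕ) → (Fin M₁ → E3) → Fin M₁ → ℝ → ℝ} (h : DominationRBentW Ψ) : DominationRBentG Ψ :=
  recutDomination_anti chartFamilyRWS_le kLb_le_kL0 h

/-- (F3ᴿ-bentW) ⟹ (F3ᴿ-bentG). [formal bookkeeping] -/
theorem familyCertRBentG_of_W (h : FamilyCertRBentW) : FamilyCertRBentG := familyCertRecut_anti chartFamilyRWS_le kLb_le_kL0 h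

/-- (R7ᴸ) at the OLD radius on the OLD family ⟹ (R7ᴸ). [formal bookkeeping] -/
theorem recutGoodG_of_RW (h : RecutGoodWith ChartFamilyRW kL0) : RecutGoodG := (h.anti_radius kLb_le_kL0).anti chartFamilyRWS_le

/-- (ROOMᴸ) ⟹ the W-record's (F2ᴿ-bentW0) restricted to `𝓘₀ᴿʷˢ` (forget LS-nearness). [formal bookkeeping] -/
theorem familyRoomG_of_LSG (h : FamilyRoomLSG) : FamilyRoom ChartFamilyRWS (24 / 5) (1 / 100) etaE tau0 T0 := familyRoom_of_familyRoomQ h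

/-- ★★★ (RFᴿ)ᴸ IS A THEOREM: (R7ᴸ) ⟹ `RecutLSG`. [folklore] -/
theorem recutLSG_of_good (h : RecutGoodG) : RecutLSG := affineRecutQ_of_good (by norm_num [kLb]) (by norm_num [kLb]) h

/-- ★★★ (R7ᴸ) HOLDS at `κ♭₀ = 3/20`. [folklore] -/
theorem recutGoodG_holds : RecutGoodG := recutGoodWith_of_le (by norm_num [kLb]) (by norm_num [kLb])

/-- ★★★★ **(RFᴿ)ᴸ HOLDS UNCONDITIONALLY** — `RecutLSG`: every admissible clean mono-phase cluster charted by `z₀ ∈ 𝓘₀ᴿʷˢ` with a `κ♭₀·t`-small chart-side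
least-squares matrix is coarsely charted by a `κN₁·t`-level-near `κ♭₀·t`-recut in `𝓘₁ʷ` carrying the projected affine-free deviation.  NO kinematic binder is left
in the record below. [folklore] -/
theorem recutLSG_holds : RecutLSG := recutLSG_of_good recutGoodG_holds

/-- ★★ LEVEL-2 NODE (G): (BASᴿ-bentG) ∧ (T2-bentW, UNPAIRED) ∧ (MEMᴿ-bentG μ) ∧ (LINᴿ-bentG Ψ) ⟹ (ENVᴿ-bentG (Ψ + ϱ₀ + μ)). [folklore] -/
theorem envelopeRBentG_of_taylor {Ψ : (M₁ : ℕ) → (Fin M₁ → E3) → Fin M₁ → ℝ → ℝ} {μ : (M₁ : ℕ) → (Fin M₁ → E3) → Fin M₁ → ℝ} (hB : BasinRBentG)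
    (hT : TaylorTwoBentW) (hM : MembershipRBentG μ) (hL : SlavedRBentG Ψ) : EnvelopeRBentG (withColumns Ψ μ) :=
  pairedEnvelopeOn_of_taylor hB hT hM hL

/-- ★★ LEVEL-1 NODE (G): (RFᴿ)ᴸ ∧ (ENVᴿ-bentG Ψ) ∧ (DOMᴿ-bentG Ψ) ⟹ (F1ᴿ-cap)ᴸ. [folklore] -/
theorem familyEnvelopeCapRBentG_of_pieces {Ψ : (M₁ : ℕ) → (Fin M₁ → E3) → Fin M₁ → ℝ → ℝ} (hRF : RecutLSG) (hE : EnvelopeRBentG Ψ)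
    (hD : DominationRBentG Ψ) : FamilyEnvelopeCapRBentG :=
  familyEnvelopeRecutCapQ_of_pieces hRF hE hD

/-- ★★ LEVEL-0 NODE (G), EDGE BAND: (F1ᴿ-cap)ᴸ ∧ (ROOMᴸ) ∧ (F3ᴿ-bentG) ⟹ `EdgeFarFloor (63/10) (63/10) (24/5) (1/100) (3/50) 0`. [folklore] -/
theorem edgeFar_capRBentG (hE : FamilyEnvelopeCapRBentG) (hR : FamilyRoomLSG) (hC : FamilyCertRBentG) :
    EdgeFarFloor (63 / 10) (63 / 10) (24 / 5) (1 / 100) (3 / 50) 0 := by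
  have h := edgeFar_of_familyRecutCapQ hE hR hC
  rwa [etaE] at h

/-- ★★★★ **THE ♭ RECORD `coreOff_record_g55b`** — [CORE-FAR] `CoreOffTubeFloor (63/10) (63/10) (24/5) (1/100) 0` from EIGHT named binders, NONE OF THEM KINEMATIC:
(BASᴿ-bentG) · (MEMᴿ-bentG μ) · (LINᴿ-bentG Ψ) · (DOMᴿ-bentG (Ψ+ϱ₀+μ)) · (ROOMᴸ) · (F3ᴿ-bentG) · [BRIDGE] · [SOFT-FAR].  (T2-bentW) is the tree theorem `taylorTwoBentW_holds`;
(RFᴿ)ᴸ — existence, recut-nearness, membership, coarse chart, LEVEL (R6) and GOOD WINDOW (R7) — is the theorem `recutLSG_holds`; (R1) lives inside (ROOMᴸ) (∃-side);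
every table / analytic binder is its `g54W` counterpart restricted to (`𝓘₀ᴿʷˢ`, radius `κ♭₀`) and is implied by it (`coreOff_record_g55b_of_W`). [folklore] -/
theorem coreOff_record_g55b {Ψ : (M₁ : ℕ) → (Fin M₁ → E3) → Fin M₁ → ℝ → ℝ} {μ : (M₁ : ℕ) → (Fin M₁ → E3) → Fin M₁ → ℝ} (hB : BasinRBentG)
    (hM : MembershipRBentG μ) (hL : SlavedRBentG Ψ) (hD : DominationRBentG (withColumns Ψ μ)) (hR : FamilyRoomLSG) (hC : FamilyCertRBentG)
    (hBand : BandFarFloor (63 / 10) (63 / 10) (24 / 5) (1 / 100) (3 / 50) (1 / 10) 0) (hS : SoftFarFloor (63 / 10) (63 / 10) (24 / 5) (1 / 100) (1 / 10) 0) :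
    CoreOffTubeFloor (63 / 10) (63 / 10) (24 / 5) (1 / 100) 0 :=
  coreOff_of_edge_of_band_of_soft
    (edgeFar_capRBentG (familyEnvelopeCapRBentG_of_pieces recutLSG_holds (envelopeRBentG_of_taylor hB taylorTwoBentW_holds hM hL) hD) hR hC) hBand hS

/-- ★★★ THE ♭ RECORD, EDGE BAND: the six non-floor binders ⟹ `EdgeFarFloor (63/10) (63/10) (24/5) (1/100) (3/50) 0`. [folklore] -/
theorem edgeFar_record_g55b {Ψ : (M₁ : ℕ) → (Fin M₁ → E3) → Fin M₁ → ℝ → ℝ} {μ : (M₁ : ℕ) → (Fin M₁ → E3) → Fin M₁ → ℝ} (hB : BasinRBentG)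
    (hM : MembershipRBentG μ) (hL : SlavedRBentG Ψ) (hD : DominationRBentG (withColumns Ψ μ)) (hR : FamilyRoomLSG) (hC : FamilyCertRBentG) :
    EdgeFarFloor (63 / 10) (63 / 10) (24 / 5) (1 / 100) (3 / 50) 0 :=
  edgeFar_capRBentG (familyEnvelopeCapRBentG_of_pieces recutLSG_holds (envelopeRBentG_of_taylor hB taylorTwoBentW_holds hM hL) hD) hR hC

/-- ★★★ THE ♭ RECORD FROM THE W-RECORD'S BINDERS — the `g54W` binders (BASᴿ-bentW) (MEMᴿ-bentW μ) (LINᴿ-bentW Ψ) (DOMᴿ-bentW (Ψ+ϱ₀+μ)) (F3ᴿ-bentW) as they stand,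
plus (ROOMᴸ), give [CORE-FAR]: relative to `coreOff_record_g54W_T2` the binder (RFᴿ-bentW) is DELETED and (F2ᴿ-bentW0) is replaced by (ROOMᴸ); nothing else. [folklore] -/
theorem coreOff_record_g55b_of_W {Ψ : (M₁ : ℕ) → (Fin M₁ → E3) → Fin M₁ → ℝ → ℝ} {μ : (M₁ : ℕ) → (Fin M₁ → E3) → Fin M₁ → ℝ} (hB : BasinRBentW)
    (hM : MembershipRBentW μ) (hL : SlavedRBentW Ψ) (hD : DominationRBentW (withColumns Ψ μ)) (hR : FamilyRoomLSG) (hC : FamilyCertRBentW)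
    (hBand : BandFarFloor (63 / 10) (63 / 10) (24 / 5) (1 / 100) (3 / 50) (1 / 10) 0) (hS : SoftFarFloor (63 / 10) (63 / 10) (24 / 5) (1 / 100) (1 / 10) 0) :
    CoreOffTubeFloor (63 / 10) (63 / 10) (24 / 5) (1 / 100) 0 :=
  coreOff_record_g55b (basinRBentG_of_W hB) (membershipRBentG_of_W hM) (slavedRBentG_of_W hL) (dominationRBentG_of_W hD) hR (familyCertRBentG_of_W hC)
    hBand hS

end Summit.AtomisticToContinuum.Crystallization.Theorems.FrustratedLawDichotomyStrainedPatchRecutLS
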